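import Summits.CriticalPhenomena.PercolationContinuityZ3.Theorems.PercNearOneGluingNoHeavyLowerTailIncStarRootEdgeInduction
import Summits.CriticalPhenomena.PercolationContinuityZ3.Theorems.PercNearOneGluingNoHeavyLowerTailIncStarRootTargetStep
import HarnessLib

/-!
# The increasing star `E₃({s↔b},{s↔c},{s↔y}) ≥ 0`, conditionally on ONE remaining family: Bernstein positivity along ROOT–UNMARKED edges

Support file for the Sahi programme (`--supports stmt-CriticalPhenomena-4575`, prover prim-sahi-p2 gen 4).  No definitions, no named facts, no sorries;
standard axioms.  Assembly of the root-edge induction (`IncStar.incStar_nonneg_of_rootEdgeBernsteinIH`) with the PROVED root–target step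
(`IncStar.rootTarget_polar_nonneg`, exact cone certificates): what remains is the root–UNMARKED step — for `e = s(s,z)` with `z ∉ {s,b,c,y}`, the two
mixed Bernstein coefficients of `p_e ↦ E₃({s↔b},{s↔c},{s↔y})` are nonnegative (five-point forms; census-clean, three-copy fibre-positive on `K₅` and on
random graphs `n ≤ 7`, exhaustive `n ≤ 7` by ttrl2; NOT in the light degree-3 cone — memo FROM-prim-sahi-p2-gen4-INC-STAR.md §8).  Given that family,
`incStar_nonneg_of_rootUnmarkedBernstein` is the increasing star on every finite weighted graph on `Fin n`.
-/

noncomputable section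

namespace Summit.CriticalPhenomena.PercolationContinuityZ3.Theorems

namespace IncStar

open MeasureTheory Set Literature.Probability.Percolation Literature.Probability.LatticeModels EdgeInduction
open scoped Classical

variable {n : ℕ}

/-- `polar₁` is symmetric under exchanging the first two events. [folklore] -/
theorem polar₁_comm₁₂ (μ ν : Measure (BondConfig (Fin n))) (A B C : Set (BondConfig (Fin n))) :
    polar₁ μ ν A B C = polar₁ μ ν B A C := by
  unfold polar₁
  rw [Set.inter_comm B A]
  ring

/-- `polar₁` is symmetric under exchanging the last two events. [folklore] -/
theorem polar₁_comm₂₃ (μ ν : Measure (BondConfig (Fin n))) (A B C : Set (BondConfig (Fin n))) :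
    polar₁ μ ν A B C = polar₁ μ ν A C B := by
  unfold polar₁
  rw [Set.inter_assoc A C B, Set.inter_comm C B, ← Set.inter_assoc]
  ring

/-- **The increasing star from the root–unmarked Bernstein step.**  If for every weight, all markings `s b c y` and every vertex `z ∉ {s,b,c,y}` the
two mixed Bernstein coefficients of the increasing star along `e = s(s,z)` are nonnegative whenever the increasing star holds under `P_{w[e↦0]}` and
`P_{w[e↦1]}` (the induction hypotheses), then `E₃({s↔b},{s↔c},{s↔y}) ≥ 0` on every finite weighted graph on `Fin n`.  The root–TARGET steps are
supplied by `rootTarget_polar_nonneg`. [this work] -/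
theorem incStar_nonneg_of_rootUnmarkedBernstein
    (hRZ : ∀ (w : Sym2 (Fin n) → unitInterval) (s b c y z : Fin n), z ≠ s → z ≠ b → z ≠ c → z ≠ y →
      0 ≤ sahiE3 (prodBernoulli (Function.update w s(s, z) 0)) (openConn s b) (openConn s c) (openConn s y) →
      0 ≤ sahiE3 (prodBernoulli (Function.update w s(s, z) 1)) (openConn s b) (openConn s c) (openConn s y) →
      0 ≤ polar₁ (prodBernoulli (Function.update w s(s, z) 0)) (prodBernoulli (Function.update w s(s, z) 1))
            (openConn s b) (openConn s c) (openConn s y) ∧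
        0 ≤ polar₁ (prodBernoulli (Function.update w s(s, z) 1)) (prodBernoulli (Function.update w s(s, z) 0))
            (openConn s b) (openConn s c) (openConn s y)) :
    ∀ (w : Sym2 (Fin n) → unitInterval) (s b c y : Fin n),
      0 ≤ sahiE3 (prodBernoulli w) (openConn s b) (openConn s c) (openConn s y) := by
  refine incStar_nonneg_of_rootEdgeBernsteinIH ?_
  intro w s b c y v hvs h0 h1
  by_cases hvb : v = b
  · subst hvb
    exact rootTarget_polar_nonneg w s v c y (Ne.symm hvs) h0
  by_cases hvc : v = c
  · subst hvc
    have h0' : 0 ≤ sahiE3 (prodBernoulli (Function.update w s(s, v) 0)) (openConn s v) (openConn s b) (openConn s y) := by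
      rwa [sahiE3_comm₁₂]
    obtain ⟨p1, p2⟩ := rootTarget_polar_nonneg w s v b y (Ne.symm hvs) h0'
    exact ⟨by rwa [polar₁_comm₁₂], by rwa [polar₁_comm₁₂]⟩
  by_cases hvy : v = y
  · subst hvy
    have h0' : 0 ≤ sahiE3 (prodBernoulli (Function.update w s(s, v) 0)) (openConn s v) (openConn s c) (openConn s b) := by
      rw [sahiE3_comm₂₃, sahiE3_comm₁₂, sahiE3_comm₂₃]; exact h0
    obtain ⟨p1, p2⟩ := rootTarget_polar_nonneg w s v c b (Ne.symm hvs) h0'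
    refine ⟨?_, ?_⟩
    · rw [polar₁_comm₂₃, polar₁_comm₁₂, polar₁_comm₂₃]; exact p1
    · rw [polar₁_comm₂₃, polar₁_comm₁₂, polar₁_comm₂₃]; exact p2
  exact hRZ w s b c y v hvs hvb hvc hvy h0 h1

end IncStar

end Summit.CriticalPhenomena.PercolationContinuityZ3.Theorems
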